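import Literature.NumberTheory.GaloisRepresentations.ContinuousCorestriction
import Literature.NumberTheory.GaloisRepresentations.ContinuousCohomologyConnecting
import Literature.NumberTheory.GaloisRepresentations.CohomologicalDimensionTowerProofs
import Literature.NumberTheory.GaloisRepresentations.BrauerTower
import HarnessLib

/-!
# The action of `G/N` on `Hⁿ(N, X)`: inner automorphisms, restriction, and descent along an
# index acting invertibly (Serre I §2.4–2.6, Corps locaux VII §5)

Topic `NumberTheory/GaloisRepresentations`; namespace `Literature.NumberTheory.GaloisRepresentations`.
Theorems only (no definition, no named fact; D-0026).

Let `G` be a topological group, `N ⊴ G` a normal subgroup and `X` a topological `G`-module.  The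
tree's `conjMap X N g n : Hⁿ(N, X) → Hⁿ(N, X)` (`ContinuousCorestriction.lean`) is the action of
`g ∈ G` (on cocycles `(g·φ)(x) = g φ(g⁻¹ x g)`).  This file proves, in degrees `n = 1, 2` and on
explicit continuous cocycles:

* `map_eq_map_of_inner_one/two` — **inner automorphisms act trivially**: for a continuous
  `ι : H → G` and the pair `(x ↦ g⁻¹ ι(x) g, v ↦ g v)`, the induced map `Hⁿ(G, X) → Hⁿ(H, Y)` equals
  the one induced by `(ι, id)` (Serre, *Corps locaux*, VII §5 Prop. 3; the coboundaries are
  `∂(φ(g))` and `∂(x ↦ z(g, g⁻¹xg) - z(x, g))`); hence `conjMap` by elements of `N` is the identity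
  (`conjMap_eq_self_of_mem_one/two`), `conjMap ∘ res = res` (`conjMap_resSubgroup_one/two`), and
  `conjMap h ∘ conjMap g = conjMap (h g)` (`conjMap_conjMap`), `conjMap 1 = id`;
* `cohomologyMap_conjMap` — **naturality**: `Hⁿ(λ) (g · y) = g · Hⁿ(λᵍ) y` for an `N`-morphism
  `λ : X → X'` and `λᵍ = g⁻¹ λ g`;
* `resSubgroup_cores_eq_sum` — **`res ∘ cor = Σ_{x ∈ G/N} conjMap (s x)`** on `H¹(N, X)` for `N` open of
  finite index (from the tree's explicit transfer `cores`, NSW I §5);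
* `resSubgroup_one_injective`, `exists_resSubgroup_one_eq_of_forall_conjMap_eq` — **descent in degree
  one**: if `(G : N)` acts invertibly on `X` (e.g. `X` is `p`-primary and `p ∤ (G : N)`), then
  `res : H¹(G, X) → H¹(N, X)` is injective with image the `G`-invariant classes
  (`cor ∘ res = (G:N)`, `res ∘ cor = Σ conj`; Serre I §2.4 Prop. 9, *Corps locaux* VII §6);
* `resSubgroup_two_injective`, `exists_resSubgroup_two_eq_of_forall_conjMap_eq` — **the same in
  degree two** for a discrete module over a profinite `G` and `N` open, by dimension shifting
  through the coinduced module `C(G, X)` (`G`- and `N`-acyclic: `subsingleton_coind`,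
  `subsingleton_coind_restrict`), using the naturality of the connecting map `δ₁` with respect to
  restriction and to the `G/N`-action (`resSubgroup_δ₁`, `conjMap_δ₁`).

## References
* J.-P. Serre, *Corps locaux* (1968) / *Local Fields* (1979), VII §5 (Prop. 3: inner automorphisms
  act trivially; the `G/H`-module `H^q(H, A)`), VII §6. [SerreLocalFields1979]
* J.-P. Serre, *Cohomologie galoisienne* / *Galois Cohomology* (1997), I §2.4 Prop. 9
  (`Cor ∘ Res`), I §2.5, I §2.6 (b). [SerreGaloisCohomology1997]
* J. Neukirch, A. Schmidt, K. Wingberg, *Cohomology of Number Fields* (2008), I §5 (cor on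
  inhomogeneous cochains, (1.5.6)–(1.5.7) `res ∘ cor = N_{G/U}`), (1.6.2). [NeukirchSchmidtWingberg2008]
-/

noncomputable section

open CategoryTheory Function

universe u v

namespace Literature.NumberTheory.GaloisRepresentations

open _root_.TopRep _root_.ContRepresentation _root_.ContinuousCohomology
open Literature.NumberTheory.EllipticCurves (subgroupConj subgroupConj_apply_coe schreierElt
  schreierElt_coe schreierElt_coe_eq_subgroupConj coe_smul_quotient_eq)

/-! ### Inner automorphisms act trivially on `H¹` and `H²` -/

section Inner

variable {R : Type u} [CommRing R] [TopologicalSpace R]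
variable {G : Type v} [Group G] [TopologicalSpace G] [IsTopologicalGroup G]
variable {H : Type v} [Group H] [TopologicalSpace H] [IsTopologicalGroup H]
variable {X : TopRep.{v} R G} {Y : TopRep.{v} R H}

omit [IsTopologicalGroup G] in
/-- `φ(g⁻¹) = -g⁻¹ φ(g)` for a continuous crossed homomorphism. [folklore] -/
theorem contOneCocycles.apply_inv (φ : contOneCocycles X) (g : G) :
    φ.1 g⁻¹ = -(X.ρ g⁻¹ (φ.1 g)) := by
  have h := φ.2 g⁻¹ g
  rw [inv_mul_cancel, contOneCocycles.apply_one] at h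
  rw [eq_neg_iff_add_eq_zero, h]

/-- **Inner automorphisms act trivially on `H¹`** (Serre, *Corps locaux*, VII §5 Prop. 3), in the
relative form: for `ι, θ : H → G` with `θ(x) = g⁻¹ ι(x) g` and compatible module maps
`f₁ = f₂ ∘ g`, the maps `H¹(G, X) → H¹(H, Y)` induced by `(θ, f₁)` and `(ι, f₂)` agree
(`g·φ(g⁻¹xg) - φ(x) = x φ(g) - φ(g)` on cocycles). [cite: SerreLocalFields1979, VII §5 Prop. 3] -/
theorem map_eq_map_of_inner_one (g : G) (ι θ : H →ₜ* G) (hθ : ∀ x, θ x = g⁻¹ * ι x * g)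
    (f₁ : res (θ : H →* G) X ⟶ Y) (f₂ : res (ι : H →* G) X ⟶ Y)
    (hf : ∀ v, f₁.hom v = f₂.hom (X.ρ g v)) (x : continuousCohomology 1 X) :
    ContinuousCohomology.map θ f₁ 1 x = ContinuousCohomology.map ι f₂ 1 x := by
  obtain ⟨φ, rfl⟩ := oneCocycleClass_surjective X x
  rw [map_oneCocycleClass, map_oneCocycleClass, ← sub_eq_zero, ← oneCocycleClass_sub,
    oneCocycleClass_eq_zero_iff]
  refine ⟨f₂.hom (φ.1 g), fun σ => ?_⟩
  change f₁.hom (φ.1 (θ σ)) - f₂.hom (φ.1 (ι σ)) = Y.ρ σ (f₂.hom (φ.1 g)) - f₂.hom (φ.1 g)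
  rw [hf, hθ, φ.2 (g⁻¹ * ι σ) g, φ.2 g⁻¹ (ι σ), contOneCocycles.apply_inv]
  simp only [map_add, map_neg, ρ_apply_ρ_inv_apply]
  rw [← ρ_mul_apply, mul_inv_cancel_left]
  have hc : f₂.hom (X.ρ (ι σ) (φ.1 g)) = Y.ρ σ (f₂.hom (φ.1 g)) := TopRep.hom_comm_apply f₂ σ _
  rw [hc]
  abel

variable [LocallyCompactSpace G] [LocallyCompactSpace H]

/-- **Inner automorphisms act trivially on `H²`** (Serre, *Corps locaux*, VII §5 Prop. 3), relative
form as in `map_eq_map_of_inner_one`: on `2`-cocycles `g·z(g⁻¹σg, g⁻¹τg) - z(σ, τ) = (∂b)(σ, τ)` with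
`b(σ) = z(g, g⁻¹σg) - z(σ, g)` (three instances of the cocycle identity).
[cite: SerreLocalFields1979, VII §5 Prop. 3] -/
theorem map_eq_map_of_inner_two (g : G) (ι θ : H →ₜ* G) (hθ : ∀ x, θ x = g⁻¹ * ι x * g)
    (f₁ : res (θ : H →* G) X ⟶ Y) (f₂ : res (ι : H →* G) X ⟶ Y)
    (hf : ∀ v, f₁.hom v = f₂.hom (X.ρ g v)) (x : continuousCohomology 2 X) :
    ContinuousCohomology.map θ f₁ 2 x = ContinuousCohomology.map ι f₂ 2 x := by
  obtain ⟨z, rfl⟩ := twoCocycleClass_surjective X x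
  rw [map_twoCocycleClass, map_twoCocycleClass, ← sub_eq_zero, ← twoCocycleClass_sub,
    twoCocycleClass_eq_zero_iff]
  let b : C(H, Y) := ⟨fun σ => f₂.hom (z.1 (g, g⁻¹ * ι σ * g) - z.1 (ι σ, g)),
    f₂.hom.continuous.comp ((z.1.continuous.comp (continuous_const.prodMk
      ((continuous_const.mul ι.continuous).mul continuous_const))).sub
      (z.1.continuous.comp (ι.continuous.prodMk continuous_const)))⟩
  refine ⟨b, fun σ τ => ?_⟩
  change f₁.hom (z.1 (θ σ, θ τ)) - f₂.hom (z.1 (ι σ, ι τ)) =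
    Y.ρ σ (f₂.hom (z.1 (g, g⁻¹ * ι τ * g) - z.1 (ι τ, g))) -
      f₂.hom (z.1 (g, g⁻¹ * ι (σ * τ) * g) - z.1 (ι (σ * τ), g)) +
      f₂.hom (z.1 (g, g⁻¹ * ι σ * g) - z.1 (ι σ, g))
  -- three instances of the cocycle identity
  have C1 := z.2 (ι σ) g (g⁻¹ * ι τ * g)
  have C2 := z.2 g (g⁻¹ * ι σ * g) (g⁻¹ * ι τ * g)
  have C3 := z.2 (ι σ) (ι τ) g
  have e1 : g * (g⁻¹ * ι τ * g) = ι τ * g := by group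
  have e2 : g⁻¹ * ι σ * g * (g⁻¹ * ι τ * g) = g⁻¹ * ι (σ * τ) * g := by rw [map_mul]; group
  have e3 : g * (g⁻¹ * ι σ * g) = ι σ * g := by group
  rw [e1] at C1
  rw [e2, e3] at C2
  rw [← map_mul ι] at C3
  rw [hf, hθ, hθ, ← TopRep.hom_comm_apply f₂ σ, ← map_sub, ← map_sub, ← map_add]
  refine congrArg f₂.hom ?_
  change X.ρ g (z.1 (g⁻¹ * ι σ * g, g⁻¹ * ι τ * g)) - z.1 (ι σ, ι τ) =
    X.ρ (ι σ) (z.1 (g, g⁻¹ * ι τ * g) - z.1 (ι τ, g)) -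
      (z.1 (g, g⁻¹ * ι (σ * τ) * g) - z.1 (ι (σ * τ), g)) +
      (z.1 (g, g⁻¹ * ι σ * g) - z.1 (ι σ, g))
  rw [map_sub, eq_sub_of_add_eq C1, eq_sub_of_add_eq C2, eq_sub_of_add_eq C3]
  abel

end Inner

/-! ### The `G/N`-action: elements of `N`, restriction, composition, naturality -/

section Conj

variable {R : Type u} [CommRing R] [TopologicalSpace R]
variable {G : Type v} [Group G] [TopologicalSpace G] [IsTopologicalGroup G]
variable (X : TopRep.{v} R G) (N : Subgroup G) [N.Normal]

omit [N.Normal] in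
/-- `map (id, id) = id` on `H¹`, via cocycles. [folklore] -/
theorem map_id_id_one {H : Type v} [Group H] [TopologicalSpace H] [IsTopologicalGroup H]
    (Z : TopRep.{v} R H) (y : continuousCohomology 1 Z) :
    ContinuousCohomology.map (ContinuousMonoidHom.id H)
      (TopRep.ofHom ⟨ContinuousLinearMap.id R Z, fun _ => rfl⟩ :
        res ((ContinuousMonoidHom.id H : H →ₜ* H) : H →* H) Z ⟶ Z) 1 y = y := by
  obtain ⟨φ, rfl⟩ := oneCocycleClass_surjective _ y
  rw [map_oneCocycleClass]
  exact congrArg _ (Subtype.ext (ContinuousMap.ext fun _ => rfl))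

omit [N.Normal] in
/-- `map (id, id) = id` on `H²`, via cocycles. [folklore] -/
theorem map_id_id_two {H : Type v} [Group H] [TopologicalSpace H] [IsTopologicalGroup H]
    [LocallyCompactSpace H] (Z : TopRep.{v} R H) (y : continuousCohomology 2 Z) :
    ContinuousCohomology.map (ContinuousMonoidHom.id H)
      (TopRep.ofHom ⟨ContinuousLinearMap.id R Z, fun _ => rfl⟩ :
        res ((ContinuousMonoidHom.id H : H →ₜ* H) : H →* H) Z ⟶ Z) 2 y = y := by
  obtain ⟨z, rfl⟩ := twoCocycleClass_surjective _ y
  rw [map_twoCocycleClass]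
  exact congrArg _ (Subtype.ext (ContinuousMap.ext fun _ => rfl))

/-- **Elements of `N` act trivially on `H¹(N, X)`.** [cite: SerreLocalFields1979, VII §5 Prop. 3] -/
theorem conjMap_eq_self_of_mem_one {n : G} (hn : n ∈ N) (y : continuousCohomology 1 (subgroupRep X N)) :
    conjMap X N n 1 y = y := by
  have h := map_eq_map_of_inner_one (X := subgroupRep X N) (Y := subgroupRep X N) (⟨n, hn⟩ : N)
    (ContinuousMonoidHom.id N) (subgroupConj N n) (fun x => Subtype.ext (by
      rw [subgroupConj_apply_coe]; rfl))
    (conjRepHom X N n) (TopRep.ofHom ⟨ContinuousLinearMap.id R X, fun _ => rfl⟩) (fun _ => rfl) y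
  rw [conjMap, h, map_id_id_one]

/-- **Elements of `N` act trivially on `H²(N, X)`.** [cite: SerreLocalFields1979, VII §5 Prop. 3] -/
theorem conjMap_eq_self_of_mem_two [LocallyCompactSpace N] {n : G} (hn : n ∈ N)
    (y : continuousCohomology 2 (subgroupRep X N)) : conjMap X N n 2 y = y := by
  have h := map_eq_map_of_inner_two (X := subgroupRep X N) (Y := subgroupRep X N) (⟨n, hn⟩ : N)
    (ContinuousMonoidHom.id N) (subgroupConj N n) (fun x => Subtype.ext (by
      rw [subgroupConj_apply_coe]; rfl))
    (conjRepHom X N n) (TopRep.ofHom ⟨ContinuousLinearMap.id R X, fun _ => rfl⟩) (fun _ => rfl) y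
  rw [conjMap, h, map_id_id_two]

/-- `1 ∈ G` acts trivially on `H¹(N, X)`. [folklore] -/
theorem conjMap_one_one (y : continuousCohomology 1 (subgroupRep X N)) : conjMap X N 1 1 y = y :=
  conjMap_eq_self_of_mem_one X N N.one_mem y

/-- `1 ∈ G` acts trivially on `H²(N, X)`. [folklore] -/
theorem conjMap_one_two [LocallyCompactSpace N] (y : continuousCohomology 2 (subgroupRep X N)) :
    conjMap X N 1 2 y = y :=
  conjMap_eq_self_of_mem_two X N N.one_mem y

/-- **`conjMap h ∘ conjMap g = conjMap (h g)`** (all degrees): the action is an (anti-)action of `G`.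
[cite: SerreLocalFields1979, VII §5] -/
theorem conjMap_conjMap (g h : G) (n : ℕ) (y : continuousCohomology n (subgroupRep X N)) :
    conjMap X N h n (conjMap X N g n y) = conjMap X N (h * g) n y :=
  (map_comp_apply_of (subgroupConj N g) (subgroupConj N h) (subgroupConj N (h * g))
    (fun x => Subtype.ext (by simp only [subgroupConj_apply_coe]; group))
    (conjRepHom X N g) (conjRepHom X N h) (conjRepHom X N (h * g)) (fun v => ρ_mul_apply X h g v) n y).symm

/-- The module half `v ↦ g v : res_{x ↦ g⁻¹xg} X ⟶ X|N` of the pair computing `conjMap g ∘ res`.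
[folklore] -/
theorem conjMap_resSubgroup_aux (g : G) :
    ∀ x : N, (X.ρ g).comp ((TopRep.res (((subgroupSubtypeHom N).comp (subgroupConj N g) : N →ₜ* G) :
      N →* G) X).ρ x) = ((subgroupRep X N).ρ x).comp (X.ρ g) := fun x => by
  ext v
  change X.ρ g (X.ρ (g⁻¹ * x * g) v) = X.ρ x (X.ρ g v)
  rw [mul_assoc, ρ_mul_apply, ρ_apply_ρ_inv_apply, ρ_mul_apply]

/-- **`conjMap g ∘ res = res` on `H¹`**: restricted classes are `G`-invariant.
[cite: SerreLocalFields1979, VII §5; SerreGaloisCohomology1997, I §2.6] -/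
theorem conjMap_resSubgroup_one (g : G) (x : continuousCohomology 1 X) :
    conjMap X N g 1 (resSubgroup X N 1 x) = resSubgroup X N 1 x := by
  have h1 : conjMap X N g 1 (resSubgroup X N 1 x) =
      ContinuousCohomology.map ((subgroupSubtypeHom N).comp (subgroupConj N g))
        (TopRep.ofHom ⟨X.ρ g, conjMap_resSubgroup_aux X N g⟩) 1 x :=
    (map_comp_apply_of (subgroupSubtypeHom N) (subgroupConj N g)
      ((subgroupSubtypeHom N).comp (subgroupConj N g)) (fun _ => rfl)
      (TopRep.ofHom ⟨ContinuousLinearMap.id R X, fun _ => rfl⟩) (conjRepHom X N g)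
      (TopRep.ofHom ⟨X.ρ g, conjMap_resSubgroup_aux X N g⟩) (fun _ => rfl) 1 x).symm
  rw [h1]
  exact map_eq_map_of_inner_one g (subgroupSubtypeHom N) ((subgroupSubtypeHom N).comp (subgroupConj N g))
    (fun _ => rfl) _ _ (fun _ => rfl) x

/-- **`conjMap g ∘ res = res` on `H²`.** [cite: SerreLocalFields1979, VII §5; SerreGaloisCohomology1997, I §2.6] -/
theorem conjMap_resSubgroup_two [LocallyCompactSpace G] [LocallyCompactSpace N] (g : G)
    (x : continuousCohomology 2 X) :
    conjMap X N g 2 (resSubgroup X N 2 x) = resSubgroup X N 2 x := by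
  have h1 : conjMap X N g 2 (resSubgroup X N 2 x) =
      ContinuousCohomology.map ((subgroupSubtypeHom N).comp (subgroupConj N g))
        (TopRep.ofHom ⟨X.ρ g, conjMap_resSubgroup_aux X N g⟩) 2 x :=
    (map_comp_apply_of (subgroupSubtypeHom N) (subgroupConj N g)
      ((subgroupSubtypeHom N).comp (subgroupConj N g)) (fun _ => rfl)
      (TopRep.ofHom ⟨ContinuousLinearMap.id R X, fun _ => rfl⟩) (conjRepHom X N g)
      (TopRep.ofHom ⟨X.ρ g, conjMap_resSubgroup_aux X N g⟩) (fun _ => rfl) 2 x).symm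
  rw [h1]
  exact map_eq_map_of_inner_two g (subgroupSubtypeHom N) ((subgroupSubtypeHom N).comp (subgroupConj N g))
    (fun _ => rfl) _ _ (fun _ => rfl) x

variable {X N} in
/-- The module half `v ↦ λ(g v)` of the pair computing `H(λ) ∘ conjMap g`. [folklore] -/
theorem cohomologyMap_conjMap_aux {X' : TopRep.{v} R G} (lam : subgroupRep X N ⟶ subgroupRep X' N) (g : G) :
    ∀ x : N, (lam.hom.toContinuousLinearMap.comp (X.ρ g)).comp
      ((TopRep.res ((subgroupConj N g : N →ₜ* N) : N →* N) (subgroupRep X N)).ρ x) =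
      ((subgroupRep X' N).ρ x).comp (lam.hom.toContinuousLinearMap.comp (X.ρ g)) := fun x => by
  ext v
  change lam.hom (X.ρ g (X.ρ (g⁻¹ * x * g) v)) = X'.ρ x (lam.hom (X.ρ g v))
  rw [mul_assoc, ρ_mul_apply, ρ_apply_ρ_inv_apply, ρ_mul_apply]
  exact TopRep.hom_comm_apply lam x _

variable {X} in
/-- **Naturality of the `G/N`-action**: for an `N`-morphism `λ : X|N → X'|N` and its conjugate
`λᵍ = g⁻¹ λ g` (any `λ'` with `λ'(v) = g⁻¹ λ(g v)`), `Hⁿ(λ) (g · y) = g · Hⁿ(λᵍ) y`; in particular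
`Hⁿ(λ)` commutes with the action when `λ` is `G`-equivariant. [cite: SerreLocalFields1979, VII §5] -/
theorem cohomologyMap_conjMap {X' : TopRep.{v} R G} (lam lam' : subgroupRep X N ⟶ subgroupRep X' N)
    (g : G) (hlam' : ∀ v, lam'.hom v = X'.ρ g⁻¹ (lam.hom (X.ρ g v))) (n : ℕ)
    (y : continuousCohomology n (subgroupRep X N)) :
    cohomologyMap lam n (conjMap X N g n y) = conjMap X' N g n (cohomologyMap lam' n y) := by
  have h1 := map_comp_apply_of (subgroupConj N g) (ContinuousMonoidHom.id N) (subgroupConj N g)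
    (fun _ => rfl) (conjRepHom X N g) (resIdHom lam)
    (TopRep.ofHom ⟨lam.hom.toContinuousLinearMap.comp (X.ρ g), cohomologyMap_conjMap_aux lam g⟩) (fun _ => rfl) n y
  have h2 := map_comp_apply_of (ContinuousMonoidHom.id N) (subgroupConj N g) (subgroupConj N g)
    (fun _ => rfl) (resIdHom lam') (conjRepHom X' N g)
    (TopRep.ofHom ⟨lam.hom.toContinuousLinearMap.comp (X.ρ g), cohomologyMap_conjMap_aux lam g⟩) (fun v => by
      change lam.hom (X.ρ g v) = X'.ρ g (lam'.hom v)
      rw [hlam', ρ_apply_ρ_inv_apply]) n y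
  rw [cohomologyMap, conjMap, ← h1, h2]
  rfl

end Conj

/-! ### `res ∘ cor = Σ conj` and descent in degree one -/

section DescentOne

variable {R : Type u} [CommRing R] [TopologicalSpace R]
variable {G : Type v} [Group G] [TopologicalSpace G] [IsTopologicalGroup G]
variable (X : TopRep.{v} R G) (N : Subgroup G) [N.Normal] [Fintype (G ⧸ N)]

/-- **`res ∘ cor = Σ_{x ∈ G/N} (s x)·`** on `H¹(N, X)` for an open normal subgroup of finite index
and any system `s` of coset representatives: on cocycles, the transfer restricted to `N` is
`n ↦ Σ_x s(x) f(s(x)⁻¹ n s(x))` (`transferFun`; `n • x = x`).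
[cite: NeukirchSchmidtWingberg2008, I §5 (1.5.6)] -/
theorem resSubgroup_cores_eq_sum (hN : IsOpen (N : Set G)) {s : G ⧸ N → G}
    (hs : ∀ x : G ⧸ N, (s x : G ⧸ N) = x) (y : continuousCohomology 1 (subgroupRep X N)) :
    resSubgroup X N 1 (cores X N hN y) = ∑ x : G ⧸ N, conjMap X N (s x) 1 y := by
  obtain ⟨f, rfl⟩ := oneCocycleClass_surjective _ y
  rw [cores_oneCocycleClass X N hN hs, resSubgroup_oneCocycleClass]
  have hrhs : oneCocycleClass _ (∑ x : G ⧸ N,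
        contOneCocycles.pullback (subgroupConj N (s x)) (conjRepHom X N (s x)) f) =
      ∑ x : G ⧸ N, conjMap X N (s x) 1 (oneCocycleClass _ f) := by
    rw [← oneCocycleClassₗ_apply, map_sum]
    exact Finset.sum_congr rfl fun x _ => by rw [oneCocycleClassₗ_apply, conjMap_oneCocycleClass]
  rw [← hrhs]
  refine congrArg _ (Subtype.ext (ContinuousMap.ext fun n => ?_))
  rw [resSubgroup_pullback_apply, transferCocycle_apply, transferFun_apply, sum_apply_val']
  exact Finset.sum_congr rfl fun x _ => by
    rw [conj_pullback_apply, coe_smul_quotient_eq N n x, schreierElt_coe_eq_subgroupConj]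

omit [N.Normal] in
/-- **Restriction is injective on `H¹` when the index is a non-zero-divisor on `H¹(G, X)`**
(`cor ∘ res = (G : N)`). [cite: SerreGaloisCohomology1997, I §2.4 Prop. 9] -/
theorem resSubgroup_one_injective (hN : IsOpen (N : Set G))
    (hinj : ∀ η : continuousCohomology 1 X, (N.index : R) • η = 0 → η = 0) :
    Injective (resSubgroup X N 1) := by
  intro a b hab
  rw [← sub_eq_zero]
  apply hinj
  rw [← cores_resSubgroup X N hN]
  change cores X N hN ((resSubgroup X N 1).hom (a - b)) = 0
  rw [map_sub]
  change cores X N hN (resSubgroup X N 1 a - resSubgroup X N 1 b) = 0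
  rw [hab, sub_self, map_zero]

/-- **Descent in degree one**: if `(G : N)` acts invertibly on `H¹(N, X)` (e.g. `X` is `p`-primary
torsion and `p ∤ (G : N)`), every `G`-invariant class of `H¹(N, X)` is restricted from `H¹(G, X)`
(`res (cor y') = Σ_x (s x)·y' = (G : N) y' = y` for `(G:N) y' = y`).
[cite: SerreLocalFields1979, VII §6; SerreGaloisCohomology1997, I §2.4] -/
theorem exists_resSubgroup_one_eq_of_forall_conjMap_eq (hN : IsOpen (N : Set G))
    (hinjN : ∀ y : continuousCohomology 1 (subgroupRep X N), (N.index : R) • y = 0 → y = 0)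
    (hsurjN : ∀ y : continuousCohomology 1 (subgroupRep X N), ∃ y', (N.index : R) • y' = y)
    (y : continuousCohomology 1 (subgroupRep X N)) (hy : ∀ g : G, conjMap X N g 1 y = y) :
    ∃ x : continuousCohomology 1 X, resSubgroup X N 1 x = y := by
  classical
  obtain ⟨y', rfl⟩ := hsurjN y
  -- `y'` is invariant as well
  have hy' : ∀ g : G, conjMap X N g 1 y' = y' := fun g => by
    rw [← sub_eq_zero]
    apply hinjN
    rw [smul_sub, sub_eq_zero]
    have h := hy g
    change (conjMap X N g 1).hom ((N.index : R) • y') = (N.index : R) • y' at h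
    rwa [map_smul] at h
  refine ⟨cores X N hN y', ?_⟩
  rw [resSubgroup_cores_eq_sum X N hN QuotientGroup.out_eq' y']
  simp only [hy']
  rw [Finset.sum_const, Finset.card_univ, ← Nat.cast_smul_eq_nsmul R, Subgroup.index_eq_card,
    Nat.card_eq_fintype_card]

end DescentOne

/-! ### Multiplication by an integer acting invertibly on the coefficients -/

section Invertible

variable {R : Type u} [CommRing R] [TopologicalSpace R]
variable {H : Type v} [Group H] [TopologicalSpace H] [IsTopologicalGroup H]
variable (Z : TopRep.{v} R H) (d : R) (e : Z ⟶ Z)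

/-- If `d` has an equivariant inverse `e` on `Z`, then `d` kills no nonzero class of `H¹(H, Z)`.
[folklore] -/
theorem eq_zero_of_smul_eq_zero_one (he : ∀ v, e.hom (d • v) = v) (x : continuousCohomology 1 Z)
    (hx : d • x = 0) : x = 0 := by
  obtain ⟨φ, rfl⟩ := oneCocycleClass_surjective Z x
  rw [← oneCocycleClass_smul, oneCocycleClass_eq_zero_iff] at hx
  obtain ⟨v, hv⟩ := hx
  rw [oneCocycleClass_eq_zero_iff]
  refine ⟨e.hom v, fun σ => ?_⟩
  rw [← TopRep.hom_comm_apply e σ, ← map_sub, ← hv σ]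
  exact (he _).symm

/-- If `d` has an equivariant inverse `e` on `Z`, then every class of `H¹(H, Z)` is `d` times a
class. [folklore] -/
theorem exists_smul_eq_one (he : ∀ v, d • e.hom v = v) (x : continuousCohomology 1 Z) :
    ∃ x' : continuousCohomology 1 Z, d • x' = x := by
  obtain ⟨φ, rfl⟩ := oneCocycleClass_surjective Z x
  refine ⟨oneCocycleClass Z (contOneCocycles.pullback (ContinuousMonoidHom.id H) (resIdHom e) φ), ?_⟩
  rw [← oneCocycleClass_smul]
  exact congrArg _ (Subtype.ext (ContinuousMap.ext fun σ => he _))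

variable [LocallyCompactSpace H]

/-- If `d` has an equivariant inverse `e` on `Z`, then `d` kills no nonzero class of `H²(H, Z)`.
[folklore] -/
theorem eq_zero_of_smul_eq_zero_two (he : ∀ v, e.hom (d • v) = v) (x : continuousCohomology 2 Z)
    (hx : d • x = 0) : x = 0 := by
  obtain ⟨z, rfl⟩ := twoCocycleClass_surjective Z x
  rw [← twoCocycleClass_smul, twoCocycleClass_eq_zero_iff] at hx
  obtain ⟨b, hb⟩ := hx
  rw [twoCocycleClass_eq_zero_iff]
  refine ⟨(e.hom : C(Z, Z)).comp b, fun σ τ => ?_⟩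
  change z.1 (σ, τ) = Z.ρ σ (e.hom (b τ)) - e.hom (b (σ * τ)) + e.hom (b σ)
  rw [← TopRep.hom_comm_apply e σ, ← map_sub, ← map_add, ← hb σ τ]
  exact (he _).symm

/-- If `d` has an equivariant inverse `e` on `Z`, then every class of `H²(H, Z)` is `d` times a
class. [folklore] -/
theorem exists_smul_eq_two (he : ∀ v, d • e.hom v = v) (x : continuousCohomology 2 Z) :
    ∃ x' : continuousCohomology 2 Z, d • x' = x := by
  obtain ⟨z, rfl⟩ := twoCocycleClass_surjective Z x
  refine ⟨twoCocycleClass Z (contTwoCocycles.pullback (ContinuousMonoidHom.id H) (resIdHom e) z), ?_⟩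
  rw [← twoCocycleClass_smul]
  exact congrArg _ (Subtype.ext (ContinuousMap.ext fun p => he _))

end Invertible

/-! ### Dimension shifting: naturality of `δ₁` and descent in degree two -/

section DescentTwo

variable {G : Type u} [Group G] [TopologicalSpace G] [IsTopologicalGroup G] [CompactSpace G]
  [T2Space G] [TotallyDisconnectedSpace G]
variable {M₁ : Type u} [AddCommGroup M₁] [TopologicalSpace M₁] [DiscreteTopology M₁]
variable {M₂ : Type u} [AddCommGroup M₂] [TopologicalSpace M₂] [DiscreteTopology M₂]
variable {M₃ : Type u} [AddCommGroup M₃] [TopologicalSpace M₃] [DiscreteTopology M₃]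
variable {ρ₁ : ContinuousRep G ℤ M₁} {ρ₂ : ContinuousRep G ℤ M₂} {ρ₃ : ContinuousRep G ℤ M₃}
variable {f : ρ₁.toTopRep ⟶ ρ₂.toTopRep} {g : ρ₂.toTopRep ⟶ ρ₃.toTopRep}
variable (N : Subgroup G) [N.Normal]

/-- **An inverse to an invertible integer multiple, as an endomorphism of the discrete module.**
[folklore] -/
theorem exists_inverse_hom {Γ : Type u} [Group Γ] [TopologicalSpace Γ] [IsTopologicalGroup Γ]
    {M : Type u} [AddCommGroup M] [TopologicalSpace M] [DiscreteTopology M]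
    (ρ : ContinuousRep Γ ℤ M) (d : ℤ) (hd : Bijective fun m : M => d • m) :
    ∃ e : ρ.toTopRep ⟶ ρ.toTopRep, (∀ v, e.hom (d • v) = v) ∧ ∀ v, d • e.hom v = v := by
  let E : M ≃ M := Equiv.ofBijective _ hd
  have hE : ∀ v, d • E.symm v = v := fun v => E.apply_symm_apply v
  have hE' : ∀ v, E.symm (d • v) = v := fun v => E.symm_apply_apply v
  have hadd : ∀ a b, E.symm (a + b) = E.symm a + E.symm b := fun a b =>
    hd.1 (by change d • _ = d • _; rw [zsmul_add, hE, hE, hE])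
  let L : M →+ M :=
    { toFun := E.symm
      map_zero' := hd.1 (by change d • _ = d • _; rw [hE, zsmul_zero])
      map_add' := hadd }
  refine ⟨TopRep.ofHom ⟨⟨L.toIntLinearMap, continuous_of_discreteTopology⟩, fun σ => ?_⟩, hE', hE⟩
  ext v
  change E.symm (ρ σ v) = ρ σ (E.symm v)
  exact hd.1 (by change d • _ = d • _; rw [hE, ← map_zsmul, hE])

omit [T2Space G] [TotallyDisconnectedSpace G] in
/-- **`d` invertible on `M` is invertible on the dimension-shifting quotient `Q = C(G, M)/M`.**
[folklore] -/
theorem bijective_smul_coindQuot {M : Type u} [AddCommGroup M] [TopologicalSpace M] [DiscreteTopology M]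
    (ρ : ContinuousRep G ℤ M) (d : ℤ) (hd : Bijective fun m : M => d • m) :
    Bijective fun q : C(G, M) ⧸ ρ.constSubmodule => d • q := by
  constructor
  · intro a b hab
    change d • a = d • b at hab
    obtain ⟨A, rfl⟩ := Submodule.Quotient.mk_surjective _ a
    obtain ⟨B, rfl⟩ := Submodule.Quotient.mk_surjective _ b
    have hab' : Submodule.Quotient.mk (p := ρ.constSubmodule) (d • A) = Submodule.Quotient.mk (d • B) := by
      rw [Submodule.Quotient.mk_smul, Submodule.Quotient.mk_smul]; exact hab
    rw [Submodule.Quotient.eq, ← smul_sub, ContinuousRep.mem_constSubmodule_iff] at hab'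
    obtain ⟨c, hc⟩ := hab'
    obtain ⟨c', rfl⟩ := hd.2 c
    rw [Submodule.Quotient.eq, ContinuousRep.mem_constSubmodule_iff]
    refine ⟨c', ContinuousMap.ext fun x => hd.1 ?_⟩
    have := congr($hc x)
    change d • c' = (d • (A - B)) x at this
    exact this
  · intro q
    obtain ⟨F, rfl⟩ := Submodule.Quotient.mk_surjective _ q
    refine ⟨Submodule.Quotient.mk ⟨fun x => (Equiv.ofBijective _ hd).symm (F x),
      (continuous_of_discreteTopology (f := (Equiv.ofBijective _ hd).symm)).comp F.continuous⟩, ?_⟩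
    change Submodule.Quotient.mk (d • _) = _
    congr 1
    ext x
    exact (Equiv.ofBijective _ hd).apply_symm_apply (F x)

omit [TotallyDisconnectedSpace G] [N.Normal] in
/-- **`res ∘ δ₁ = δ₁ ∘ res`**: the connecting map of a short exact sequence of discrete `G`-modules
commutes with restriction to a subgroup (restriction of the canonical lift is a lift of the
restriction). [cite: SerreGaloisCohomology1997, I §2.2–2.4] -/
theorem resSubgroup_δ₁ [LocallyCompactSpace N] (h : IsSES f g) (hN : IsSES (restrictHom N f) (restrictHom N g))
    (x : continuousCohomology 1 ρ₃.toTopRep) :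
    resSubgroup ρ₁.toTopRep N 2 (h.δ₁ x) = hN.δ₁ (resSubgroup ρ₃.toTopRep N 1 x) := by
  obtain ⟨φ, rfl⟩ := oneCocycleClass_surjective _ x
  -- the restricted lift
  let φt : C(N, M₂) := (h.liftCocycle φ).comp ⟨((↑) : N → G), continuous_subtype_val⟩
  have hφ : ∀ σ τ : N, (restrictHom N g).hom (φt (σ * τ)) =
      (restrictHom N g).hom (φt σ) + (ρ₃.restrict (subgroupIncl N)) σ ((restrictHom N g).hom (φt τ)) :=
    fun σ τ => h.liftCocycle_isLift φ σ τ
  have e : contOneCocycles.pullback (subgroupSubtypeHom N) (Y := subgroupRep ρ₃.toTopRep N)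
      (TopRep.ofHom ⟨ContinuousLinearMap.id ℤ ρ₃.toTopRep, fun _ => rfl⟩) φ = IsSES.pushCocycle φt hφ :=
    Subtype.ext (ContinuousMap.ext fun σ => (h.g_liftCocycle_apply φ σ).symm)
  rw [h.δ₁_oneCocycleClass_eq_δ₁Aux, IsSES.δ₁Aux, resSubgroup, map_twoCocycleClass,
    resSubgroup_oneCocycleClass, e]
  erw [hN.δ₁_oneCocycleClass φt hφ]
  refine congrArg (twoCocycleClass _) (Subtype.ext (ContinuousMap.ext fun p => h.injective ?_))
  obtain ⟨σ, τ⟩ := p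
  rw [contTwoCocycles.pullback_apply]
  change f.hom ((h.connectingCocycle (h.liftCocycle φ) (h.liftCocycle_isLift φ)).1 ((σ : G), (τ : G))) =
    (restrictHom N f).hom ((hN.connectingCocycle φt hφ).1 (σ, τ))
  rw [h.f_connectingCocycle_apply, hN.f_connectingCocycle_apply]
  rfl

omit [CompactSpace G] [T2Space G] [TotallyDisconnectedSpace G] in
/-- **`conjMap ∘ δ₁ = δ₁ ∘ conjMap`**: the connecting map of the restriction to `N ⊴ G` of a short
exact sequence of discrete `G`-modules commutes with the action of `G` (the conjugate of a lift is a
lift of the conjugate). [cite: SerreLocalFields1979, VII §5] -/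
theorem conjMap_δ₁ [LocallyCompactSpace N] (h : IsSES f g) (hN : IsSES (restrictHom N f) (restrictHom N g))
    (a : G) (y : continuousCohomology 1 (ρ₃.restrict (subgroupIncl N)).toTopRep) :
    conjMap ρ₁.toTopRep N a 2 (hN.δ₁ y) = hN.δ₁ (conjMap ρ₃.toTopRep N a 1 y) := by
  obtain ⟨ψ, rfl⟩ := oneCocycleClass_surjective _ y
  -- the conjugate lift
  let ψa : C(N, M₂) :=
    ((ρ₂.toTopRep.ρ a : M₂ →L[ℤ] M₂) : C(M₂, M₂)).comp ((hN.liftCocycle ψ).comp (subgroupConj N a : C(N, N)))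
  have hψa_apply : ∀ n : N, ψa n = ρ₂ a (hN.liftCocycle ψ (subgroupConj N a n)) := fun _ => rfl
  have hgψ : ∀ n : N, g.hom (hN.liftCocycle ψ n) = ψ.1 n := fun n => hN.g_liftCocycle_apply ψ n
  have hψa : ∀ σ τ : N, (restrictHom N g).hom (ψa (σ * τ)) =
      (restrictHom N g).hom (ψa σ) + (ρ₃.restrict (subgroupIncl N)) σ ((restrictHom N g).hom (ψa τ)) := by
    intro σ τ
    rw [restrictHom_hom_apply, restrictHom_hom_apply, restrictHom_hom_apply, hψa_apply, hψa_apply, hψa_apply,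
      ContinuousRep.hom_comm_apply g a, ContinuousRep.hom_comm_apply g a, ContinuousRep.hom_comm_apply g a,
      hgψ, hgψ, hgψ, map_mul, ψ.2]
    change ρ₃ a (ψ.1 (subgroupConj N a σ) + ρ₃ ((subgroupConj N a σ : N) : G) (ψ.1 (subgroupConj N a τ))) =
      ρ₃ a (ψ.1 (subgroupConj N a σ)) + ρ₃ (σ : G) (ρ₃ a (ψ.1 (subgroupConj N a τ)))
    rw [map_add, subgroupConj_apply_coe, ← Module.End.mul_apply, ← _root_.map_mul ρ₃,
      ← Module.End.mul_apply, ← _root_.map_mul ρ₃, mul_assoc, mul_inv_cancel_left]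
  have e : (contOneCocycles.pullback (subgroupConj N a) (conjRepHom ρ₃.toTopRep N a) ψ :
      contOneCocycles (ρ₃.restrict (subgroupIncl N)).toTopRep) = IsSES.pushCocycle ψa hψa :=
    Subtype.ext (ContinuousMap.ext fun σ => by
      change ρ₃ a (ψ.1 (subgroupConj N a σ)) = g.hom (ρ₂ a (hN.liftCocycle ψ (subgroupConj N a σ)))
      rw [ContinuousRep.hom_comm_apply g a, hgψ])
  have e1 : ContinuousCohomology.map (subgroupConj N a) (conjRepHom ρ₃.toTopRep N a) 1
      (oneCocycleClass (ρ₃.restrict (subgroupIncl N)).toTopRep ψ) =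
      oneCocycleClass (ρ₃.restrict (subgroupIncl N)).toTopRep
        (contOneCocycles.pullback (subgroupConj N a) (conjRepHom ρ₃.toTopRep N a) ψ) :=
    map_oneCocycleClass _ _ _ ψ
  rw [hN.δ₁_oneCocycleClass_eq_δ₁Aux, IsSES.δ₁Aux, conjMap, conjMap, e1, e, hN.δ₁_oneCocycleClass ψa hψa]
  erw [map_twoCocycleClass]
  refine congrArg (twoCocycleClass _) (Subtype.ext (ContinuousMap.ext fun p => h.injective ?_))
  obtain ⟨σ, τ⟩ := p
  rw [contTwoCocycles.pullback_apply]
  change f.hom (ρ₁ a ((hN.connectingCocycle (hN.liftCocycle ψ) (hN.liftCocycle_isLift ψ)).1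
      (subgroupConj N a σ, subgroupConj N a τ))) =
    (restrictHom N f).hom ((hN.connectingCocycle ψa hψa).1 (σ, τ))
  rw [ContinuousRep.hom_comm_apply f a, hN.f_connectingCocycle_apply]
  have hf2 := hN.f_connectingCocycle_apply (hN.liftCocycle ψ) (hN.liftCocycle_isLift ψ)
    (subgroupConj N a σ) (subgroupConj N a τ)
  rw [restrictHom_hom_apply] at hf2
  rw [hf2, hψa_apply, hψa_apply, hψa_apply]
  change ρ₂ a (ρ₂ ((subgroupConj N a σ : N) : G) (hN.liftCocycle ψ (subgroupConj N a τ)) -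
      hN.liftCocycle ψ (subgroupConj N a σ * subgroupConj N a τ) + hN.liftCocycle ψ (subgroupConj N a σ)) =
    ρ₂ (σ : G) (ρ₂ a (hN.liftCocycle ψ (subgroupConj N a τ))) - ρ₂ a (hN.liftCocycle ψ (subgroupConj N a (σ * τ))) +
      ρ₂ a (hN.liftCocycle ψ (subgroupConj N a σ))
  rw [map_add, map_sub, map_mul (subgroupConj N a), subgroupConj_apply_coe, ← Module.End.mul_apply,
    ← _root_.map_mul ρ₂, ← Module.End.mul_apply, ← _root_.map_mul ρ₂, mul_assoc, mul_inv_cancel_left]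

variable {N}

/-- **`δ₁ : H¹(Q) → H²(M)` is injective when `H¹` of the middle term vanishes.** [folklore] -/
theorem δ₁_injective_of_subsingleton {Γ : Type u} [Group Γ] [TopologicalSpace Γ] [IsTopologicalGroup Γ]
    [LocallyCompactSpace Γ]
    {A₁ : Type u} [AddCommGroup A₁] [TopologicalSpace A₁] [DiscreteTopology A₁]
    {A₂ : Type u} [AddCommGroup A₂] [TopologicalSpace A₂] [DiscreteTopology A₂]
    {A₃ : Type u} [AddCommGroup A₃] [TopologicalSpace A₃] [DiscreteTopology A₃]
    {τ₁ : ContinuousRep Γ ℤ A₁} {τ₂ : ContinuousRep Γ ℤ A₂} {τ₃ : ContinuousRep Γ ℤ A₃}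
    {i : τ₁.toTopRep ⟶ τ₂.toTopRep} {q : τ₂.toTopRep ⟶ τ₃.toTopRep} (h : IsSES i q)
    [Subsingleton (continuousCohomology 1 τ₂.toTopRep)] : Injective h.δ₁ := by
  intro a b hab
  rw [← sub_eq_zero] at hab ⊢
  rw [← map_sub] at hab
  obtain ⟨y, hy⟩ := h.exists_map_one_eq_of_δ₁_eq_zero _ hab
  rw [← hy, Subsingleton.elim y 0, map_zero]

/-- **`δ₁ : H¹(Q) → H²(M)` is surjective when `H²` of the middle term vanishes.** [folklore] -/
theorem δ₁_surjective_of_subsingleton {Γ : Type u} [Group Γ] [TopologicalSpace Γ] [IsTopologicalGroup Γ]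
    [LocallyCompactSpace Γ]
    {A₁ : Type u} [AddCommGroup A₁] [TopologicalSpace A₁] [DiscreteTopology A₁]
    {A₂ : Type u} [AddCommGroup A₂] [TopologicalSpace A₂] [DiscreteTopology A₂]
    {A₃ : Type u} [AddCommGroup A₃] [TopologicalSpace A₃] [DiscreteTopology A₃]
    {τ₁ : ContinuousRep Γ ℤ A₁} {τ₂ : ContinuousRep Γ ℤ A₂} {τ₃ : ContinuousRep Γ ℤ A₃}
    {i : τ₁.toTopRep ⟶ τ₂.toTopRep} {q : τ₂.toTopRep ⟶ τ₃.toTopRep} (h : IsSES i q)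
    [Subsingleton (continuousCohomology 2 τ₂.toTopRep)] : Surjective h.δ₁ := fun z =>
  h.exists_δ₁_eq_of_map_two_eq_zero z (Subsingleton.elim _ _)

variable (N)
variable {M : Type u} [AddCommGroup M] [TopologicalSpace M] [DiscreteTopology M] (ρ : ContinuousRep G ℤ M)

/-- **Restriction is injective on `H²`** for an open normal subgroup `N` of a profinite group when
`(G : N)` is invertible on the discrete module `M` (dimension shifting to `resSubgroup_one_injective`).
[cite: SerreGaloisCohomology1997, I §2.4 Prop. 9, I §2.6] -/
theorem resSubgroup_two_injective [Fintype (G ⧸ N)] (hNo : IsOpen (N : Set G))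
    (hd : Bijective fun m : M => (N.index : ℤ) • m) :
    Injective (resSubgroup ρ.toTopRep N 2) := by
  haveI : IsClosed (N : Set G) := Subgroup.isClosed_of_isOpen N hNo
  haveI : LocallyCompactSpace N := hNo.isOpenEmbedding_subtypeVal.locallyCompactSpace
  have h := isSES_coind ρ
  have hN := isSES_coind_restrict N ρ
  haveI := subsingleton_coind ρ 0
  haveI := subsingleton_coind ρ 1
  haveI := subsingleton_coind_restrict N ρ 0
  -- `(G : N)` is invertible on `Q`, hence a non-zero-divisor on `H¹(G, Q)`
  obtain ⟨eQ, heQ, -⟩ := exists_inverse_hom ρ.coindQuot (N.index : ℤ)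
    (bijective_smul_coindQuot ρ _ hd)
  have hinjQ : Injective (resSubgroup ρ.coindQuot.toTopRep N 1) :=
    resSubgroup_one_injective ρ.coindQuot.toTopRep N hNo fun η hη =>
      eq_zero_of_smul_eq_zero_one ρ.coindQuot.toTopRep (N.index : ℤ) eQ heQ η hη
  intro a b hab
  obtain ⟨a', rfl⟩ := δ₁_surjective_of_subsingleton h a
  obtain ⟨b', rfl⟩ := δ₁_surjective_of_subsingleton h b
  have hab' : hN.δ₁ (resSubgroup ρ.coindQuot.toTopRep N 1 a') = hN.δ₁ (resSubgroup ρ.coindQuot.toTopRep N 1 b') :=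
    ((resSubgroup_δ₁ N h hN a').symm.trans hab).trans (resSubgroup_δ₁ N h hN b')
  obtain rfl : a' = b' := hinjQ (δ₁_injective_of_subsingleton hN hab')
  rfl

/-- **Descent in degree two**: for an open normal subgroup `N` of a profinite group `G` and a
discrete `G`-module `M` on which `(G : N)` is invertible, every `G`-invariant class of `H²(N, M)` is
restricted from `H²(G, M)` (dimension shifting `H²(·, M) ≅ H¹(·, Q)` through the `G`- and
`N`-acyclic coinduced module `C(G, M)`, then `exists_resSubgroup_one_eq_of_forall_conjMap_eq`).
[cite: SerreLocalFields1979, VII §6; SerreGaloisCohomology1997, I §2.6 (b)] -/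
theorem exists_resSubgroup_two_eq_of_forall_conjMap_eq [Fintype (G ⧸ N)] (hNo : IsOpen (N : Set G))
    (hd : Bijective fun m : M => (N.index : ℤ) • m)
    (y : continuousCohomology 2 (subgroupRep ρ.toTopRep N)) (hy : ∀ a : G, conjMap ρ.toTopRep N a 2 y = y) :
    ∃ x : continuousCohomology 2 ρ.toTopRep, resSubgroup ρ.toTopRep N 2 x = y := by
  haveI : IsClosed (N : Set G) := Subgroup.isClosed_of_isOpen N hNo
  haveI : LocallyCompactSpace N := hNo.isOpenEmbedding_subtypeVal.locallyCompactSpace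
  have h := isSES_coind ρ
  have hN := isSES_coind_restrict N ρ
  haveI := subsingleton_coind ρ 1
  haveI := subsingleton_coind_restrict N ρ 0
  haveI := subsingleton_coind_restrict N ρ 1
  obtain ⟨eQ, heQ, heQ'⟩ := exists_inverse_hom (ρ.coindQuot.restrict (subgroupIncl N)) (N.index : ℤ)
    (bijective_smul_coindQuot ρ _ hd)
  -- `y = δ₁ q` with `q ∈ H¹(N, Q)` invariant
  obtain ⟨q, rfl⟩ := δ₁_surjective_of_subsingleton hN y
  have hq : ∀ a : G, conjMap ρ.coindQuot.toTopRep N a 1 q = q := fun a =>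
    δ₁_injective_of_subsingleton hN ((conjMap_δ₁ N h hN a q).symm.trans (hy a))
  obtain ⟨x, hx⟩ := exists_resSubgroup_one_eq_of_forall_conjMap_eq ρ.coindQuot.toTopRep N hNo
    (fun η hη => eq_zero_of_smul_eq_zero_one _ (N.index : ℤ) eQ heQ η hη)
    (fun η => by
      obtain ⟨η', hη'⟩ := exists_smul_eq_one _ (N.index : ℤ) eQ heQ' η
      exact ⟨η', hη'⟩) q hq
  exact ⟨h.δ₁ x, (resSubgroup_δ₁ N h hN x).trans (congrArg hN.δ₁ hx)⟩

omit [CompactSpace G] [T2Space G] [TotallyDisconnectedSpace G] [N.Normal] in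
/-- **Restriction is injective on `H¹`** for an open normal subgroup of finite index when `(G : N)`
is invertible on the discrete module. [cite: SerreGaloisCohomology1997, I §2.4 Prop. 9] -/
theorem resSubgroup_one_injective_of_bijective [Fintype (G ⧸ N)] (hNo : IsOpen (N : Set G))
    (hd : Bijective fun m : M => (N.index : ℤ) • m) : Injective (resSubgroup ρ.toTopRep N 1) := by
  obtain ⟨e, he, -⟩ := exists_inverse_hom ρ (N.index : ℤ) hd
  exact resSubgroup_one_injective ρ.toTopRep N hNo fun η hη =>
    eq_zero_of_smul_eq_zero_one ρ.toTopRep (N.index : ℤ) e he η hη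

omit [CompactSpace G] [T2Space G] [TotallyDisconnectedSpace G] in
/-- **Descent in degree one** for an open normal subgroup of finite index when `(G : N)` is
invertible on the discrete module. [cite: SerreLocalFields1979, VII §6] -/
theorem exists_resSubgroup_one_eq_of_bijective [Fintype (G ⧸ N)] (hNo : IsOpen (N : Set G))
    (hd : Bijective fun m : M => (N.index : ℤ) • m)
    (y : continuousCohomology 1 (subgroupRep ρ.toTopRep N)) (hy : ∀ a : G, conjMap ρ.toTopRep N a 1 y = y) :
    ∃ x : continuousCohomology 1 ρ.toTopRep, resSubgroup ρ.toTopRep N 1 x = y := by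
  obtain ⟨e, he, he'⟩ := exists_inverse_hom (ρ.restrict (subgroupIncl N)) (N.index : ℤ) hd
  exact exists_resSubgroup_one_eq_of_forall_conjMap_eq ρ.toTopRep N hNo
    (fun η hη => eq_zero_of_smul_eq_zero_one _ (N.index : ℤ) e he η hη)
    (fun η => by
      obtain ⟨η', hη'⟩ := exists_smul_eq_one _ (N.index : ℤ) e he' η
      exact ⟨η', hη'⟩) y hy

end DescentTwo

end Literature.NumberTheory.GaloisRepresentations

end
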